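import Summits.Ventures.Crystal3D.Theorems.StickyWulffConstantTextureLiminfTexShadowAdhesionDefs
import Summits.Ventures.Crystal3D.Theorems.StickyWulffConstantTextureBuildHalfDefect
import HarnessLib

/-!
# TexShadow — the adhesion hypothesis in T-FORM: `BarlowAdhesionT` (plate := ALL lattice balls of the cell; the form the texture build consumes)
# (lane T, crux `TextureLiminfV5`, stmt-Ventures-23912; cf-p1 DECISION (cxxvii) «ADHESION HYPOTHESIS = T-FORM … AdhesionTDefs GO», 2026-08-29T06:04:35Z; TB-0.md §8)

HONEST FRAMING. Venture `Summits/Ventures/Crystal3D` (cell `crystal3d-full`), route `route-Ventures-StickyWulffConstant`, helper `--supports` the law-v5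
crux `TextureLiminfV5` (stmt-Ventures-23912).  ONE DEFINITION (a `Prop`, the v8.5 stub `stub_barlowAdhesionT`'s statement; owner K1 / wulff-p1 — nothing is claimed
about it here) + one unpacking lemma (pure logic).  Rung F-C1 not moved.

WHY T-FORM (TB-0.md §8, numbers not adjectives).  The texture build's tiling identity charges a crusted free surface to the tent of the host's lattice balls `P`
plus PHANTOM continuation sites `Q`; the over-charge is exactly `½Σ_Q v − ½cross(P,Q) + ½cross(P,B)` (`B` = the off-lattice crust), and it is paid by the crust's own
half-defects iff `cross(P,B) ≤ D(B) + (cross(P,Q) − D(Q)) + C·ρ` with `P` = ALL lattice balls of the cell (`…TextureBuildCrustLine.crustLine`: closes exactly,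
«slack = gain»).  The slab form `BarlowAdhesionR` (…TexShadowAdhesionDefs: plate = the clamped slab at depth `[R, 2R]` only) donates the face layers' slack
`½(vac(H′) − cross(H′,P₀))` to the crust (9-pocket: short by 3 per ball; vicinal faces: ½ per unit step) and does not close the books.

* **`BarlowAdhesionT`** — for every Hägg word, frame, origin, unit normal `ν` and radius `ρ ≥ R`, every finite packing `X` lying in the half-cylinder
  `{−2R ≤ ⟪p,ν⟫, ‖p‖² − ⟪p,ν⟫² ≤ ρ²}` in which the clamped slab `{−2R ≤ ⟪p,ν⟫ ≤ −R}` of the stacking is COMPLETE: with `P := X ∩ stacking` (ALL lattice balls) there is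
  a finite set `Q` of VACANT stacking sites with `#cross(P, X∖P) ≤ D(X∖P) + (#cross(P,Q) − D(Q)) + C·ρ` — «an off-lattice crust gains from its host at most its own
  deficiency plus the host's best lattice-continuation gain, up to a rim» (`cross(P,Q) − D(Q) = D(P) − D(P ∪ Q)` by `contactDeficiency_sdiff_split`).
* `BarlowAdhesionT.hadh` — the unpacking in `crossCount` currency: exactly the field `CrustedCover.hadh` of a crust cell with `cP = P`, `cB = X ∖ P`, `cQ = Q`, `cA = C·ρ`.
WHAT THIS IS NOT: no proof of the law (it is NRG for rough Barlow hosts — the adhesion crux proper); no claim that it implies or is implied by `BarlowAdhesionR` in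
general (they coincide on cells whose host face under the crust is a complete layer: there T's `X ∖ P` is the crust and R's slab can be placed directly under the
face); F-C1 not moved.
-/

noncomputable section

open scoped BigOperators InnerProductSpace ENNReal
open MeasureTheory Filter

namespace Summit.Ventures.Crystal3D.Cruxes.TextureLiminf.TexShadow

open Summit.Ventures.Crystal3D Summit.Ventures.Crystal3D.Theorems
open Literature.MathematicalPhysics.StatisticalMechanics (IsHaggSeq contactDeficiency)

open scoped Classical in
/-- **One-plate adhesion for every Barlow substrate, T-FORM** (plate := ALL lattice balls of the cell): see the module docstring. -/
def BarlowAdhesionT : Prop :=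
  ∃ R C : ℝ, 1 ≤ R ∧ ∀ σ : ℤ → ℤ, IsHaggSeq σ → ∀ (L : E3 ≃ₗᵢ[ℝ] E3) (s ν : E3), ‖ν‖ = 1 →
    ∀ ρ : ℝ, R ≤ ρ → ∀ X : Finset E3,
    (∀ p ∈ X, ∀ q ∈ X, p ≠ q → 1 ≤ dist p q) →
    (∀ p ∈ X, -(2 * R) ≤ ⟪p, ν⟫_ℝ ∧ ‖p‖ ^ 2 - ⟪p, ν⟫_ℝ ^ 2 ≤ ρ ^ 2) →
    (∀ p ∈ stacking L s σ, -(2 * R) ≤ ⟪p, ν⟫_ℝ → ⟪p, ν⟫_ℝ ≤ -R → ‖p‖ ^ 2 - ⟪p, ν⟫_ℝ ^ 2 ≤ ρ ^ 2 → p ∈ X) →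
    ∃ Q : Finset E3, (↑Q : Set E3) ⊆ stacking L s σ ∧ Disjoint Q X ∧
      ((((X.filter fun p => p ∈ stacking L s σ) ×ˢ (X.filter fun p => p ∉ stacking L s σ)).filter
          fun pq => dist pq.1 pq.2 = 1).card : ℝ) ≤
        contactDeficiency (X.filter fun p => p ∉ stacking L s σ) +
          ((((((X.filter fun p => p ∈ stacking L s σ) ×ˢ Q).filter fun pq => dist pq.1 pq.2 = 1).card : ℕ) : ℝ) -
            contactDeficiency Q) +
          C * ρ

open scoped Classical in
/-- **Unpacking in `crossCount` currency**: the T-form law hands every admissible cell the crust-cell budget line `CrustedCover.hadh`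
(`cP = X ∩ stacking`, `cB = X ∖ stacking`, `cQ = Q`, `cA = C·ρ`). -/
theorem BarlowAdhesionT.hadh (h : BarlowAdhesionT) :
    ∃ R C : ℝ, 1 ≤ R ∧ ∀ σ : ℤ → ℤ, IsHaggSeq σ → ∀ (L : E3 ≃ₗᵢ[ℝ] E3) (s ν : E3), ‖ν‖ = 1 →
      ∀ ρ : ℝ, R ≤ ρ → ∀ X : Finset E3,
      (∀ p ∈ X, ∀ q ∈ X, p ≠ q → 1 ≤ dist p q) →
      (∀ p ∈ X, -(2 * R) ≤ ⟪p, ν⟫_ℝ ∧ ‖p‖ ^ 2 - ⟪p, ν⟫_ℝ ^ 2 ≤ ρ ^ 2) →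
      (∀ p ∈ stacking L s σ, -(2 * R) ≤ ⟪p, ν⟫_ℝ → ⟪p, ν⟫_ℝ ≤ -R → ‖p‖ ^ 2 - ⟪p, ν⟫_ℝ ^ 2 ≤ ρ ^ 2 → p ∈ X) →
      ∃ Q : Finset E3, (↑Q : Set E3) ⊆ stacking L s σ ∧ Disjoint Q X ∧
        (crossCount (X.filter fun p => p ∈ stacking L s σ) (X.filter fun p => p ∉ stacking L s σ) : ℝ) ≤
          contactDeficiency (X.filter fun p => p ∉ stacking L s σ) +
            ((crossCount (X.filter fun p => p ∈ stacking L s σ) Q : ℝ) - contactDeficiency Q) + C * ρ := by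
  obtain ⟨R, C, hR, hT⟩ := h
  refine ⟨R, C, hR, fun σ hσ L s ν hν ρ hρ X hX hcyl hslab => ?_⟩
  obtain ⟨Q, hQS, hQX, hineq⟩ := hT σ hσ L s ν hν ρ hρ X hX hcyl hslab
  exact ⟨Q, hQS, hQX, by unfold crossCount; exact_mod_cast hineq⟩

end Summit.Ventures.Crystal3D.Cruxes.TextureLiminf.TexShadow

end
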